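import Summits.NavierStokesRegularity.NavierStokesRegularity.Theorems.TypeICertificateLadderTargetStrainCubeRung
import HarnessLib

/-!
# Crux `Target` = `TypeICertificateLadder.NoTypeIBlowup` (stmt-NavierStokesRegularity-1217), line
# `depletion-ladder`: the registered stub `stub_rungTwo` (RUNG TWO), closed by name

`--supports stmt-NavierStokesRegularity-1217`. The stub `stub_rungTwo` registered on the crux item is
`DepletionLadder.Rung 2` of the skeleton of record `Cruxes/Target/Lines/depletion_ladder.lean` — the
composition node `rungTwo_of_parts S1 S2` between the line's stubs {S1, S2} and its residual S3 — and
it is the theorem `…DepletionLadder.StrainCube.rungTwo` of `…StrainCubeRung.lean` (depletion constant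
`κ = (√3+√6)/9 < 1/2` in the Tao-slice class + flow-wise S2). With it the crux is exactly S3
(`target_iff_descentToRungTwo`). WHAT THIS IS NOT: not the crux. [folklore]
-/

noncomputable section

open Set Filter Topology
open Literature.Analysis.FluidPDE

namespace Summit.NavierStokesRegularity.NavierStokesRegularity.Theorems.DepletionLadder.StrainCube

-- the problem directory repeats the summit name (`NavierStokesRegularity/NavierStokesRegularity`)
set_option linter.dupNamespace false

/-- **Registered stub `stub_rungTwo` of crux stmt-NavierStokesRegularity-1217 (RUNG TWO, `X_2`)**:
no finite-energy classical solution of the unforced Navier–Stokes system on `ℝ³ × [0,T)` from a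
rapidly decaying datum blows up at `T` with collapse Reynolds number `√(T−t)‖u(t)‖_∞/√ν ≤ 2` near
`T`. Proof: `rungTwo`. [folklore] -/
theorem stub_rungTwo : ∀ (ν T : ℝ), 0 < ν → 0 < T → ∀ (u : ℝ → EuclideanSpace ℝ (Fin 3) → EuclideanSpace ℝ (Fin 3)) (p : ℝ → EuclideanSpace ℝ (Fin 3) → ℝ), Literature.Analysis.FluidPDE.IsClassicalNSSolutionOn (Set.Ico 0 T) ν 0 u p → Literature.Analysis.FluidPDE.IsLerayHopfOn T ν 0 (u 0) u → Literature.Analysis.FluidPDE.HasRapidSpatialDecay (u 0) → (∀ᶠ t in nhdsWithin T (Set.Iio T), ∀ x, Real.sqrt (T - t) * ‖u t x‖ ≤ 2 * Real.sqrt ν) → Literature.Analysis.FluidPDE.HasSmoothExtensionPast ν 0 u T :=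
  rungTwo

end Summit.NavierStokesRegularity.NavierStokesRegularity.Theorems.DepletionLadder.StrainCube

end
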